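import Mathlib
import Summits.NavierStokesRegularity.NavierStokesRegularity.Theorems.ThreadingFluxReynoldsQuadrupoleHarmonicBracketRigidity
import Summits.NavierStokesRegularity.NavierStokesRegularity.Theorems.ThreadingFluxCentreJetEulerTopIntegrals
import Summits.NavierStokesRegularity.NavierStokesRegularity.Theorems.ThreadingFluxCentreJetHarmonicPolhode
import HarnessLib

/-!
# Crux `PoloidalLiouville` (stmt-NavierStokesRegularity-1222, W1/W2), crux idea «reynolds-quadrupole-threading» (ns-idea-15):
# HARMONIC BRACKET RIGIDITY BY NAME — `HarmonicBracketRigidity` (ReynoldsQuadrupoleSketch l.227) with NO inputs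

Support file (`--supports stmt-NavierStokesRegularity-1222`, helper; cell `ns-wall-extremal`, width hand ns-wall-eng-3 g3; 0 kit).  The
input-free corollary of `ReynoldsQuadrupole.harmonicBracketRigidity_of_eulerTop` (`ThreadingFluxReynoldsQuadrupoleHarmonicBracketRigidity.lean`)
now that the Euler-top lemmas are tree theorems: A1 `CentreJet.eulerTopFirstIntegrals` and A2 `CentreJet.noHarmonicPolhodeInvariant`
(ns-wall-eng-5 g5, «steady-centre-sieve» card of ns-idea-15).  Statement = the sketch's body VERBATIM with the sketch-local `IsShapeTensor`
replaced by the character-identical `HorizonTower.IsShapeTensor`.  HONEST FRAME: finite-dimensional algebra about two crux ideas' typed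
objects, information-grade; rungs untouched; `PoloidalLiouville` (1222), `UnthreadedRigidity` (27585), 23843 and NS regularity OPEN.
-/

-- the summit and its single problem share the name (D-0017 nested layout)
set_option linter.dupNamespace false

noncomputable section

namespace Summit.NavierStokesRegularity.NavierStokesRegularity.Theorems.PoloidalLiouville.ReynoldsQuadrupole

open Summit.NavierStokesRegularity.NavierStokesRegularity.Theorems.PoloidalLiouville.HorizonTower

/-- ★★ **HARMONIC BRACKET RIGIDITY** (body of ReynoldsQuadrupoleSketch `HarmonicBracketRigidity`, VERBATIM with `IsShapeTensor` =
`HorizonTower.IsShapeTensor`): a degree-`l ≥ 1` harmonic polynomial `H` on `ℝ³` with `det(y, ∇H(y), My) ≡ 0` for a traceless symmetric `M`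
has `M = 0`, or `H = β·⟪y, My⟫`, or `M` uniaxial with axis `a` and `H` axisymmetric about `a`.  Inputs A1/A2 discharged by
ns-wall-eng-5 g5's `CentreJet.eulerTopFirstIntegrals` / `CentreJet.noHarmonicPolhodeInvariant`. -/
theorem harmonicBracketRigidity :
    ∀ (l : ℕ) (H : MvPolynomial (Fin 3) ℝ) (M : E3 →L[ℝ] E3), 1 ≤ l → H.IsHomogeneous l →
    (∀ y : E3, Laplacian.laplacian (fun z : E3 => MvPolynomial.eval (fun i => z i) H) y = 0) →
    IsShapeTensor M →
    (∀ y : E3, inner ℝ y (Literature.Analysis.FluidPDE.cross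
        (gradient (fun z : E3 => MvPolynomial.eval (fun i => z i) H) y) (M y)) = 0) →
    M = 0 ∨ (∃ β : ℝ, ∀ y : E3, MvPolynomial.eval (fun i => y i) H = β * inner ℝ y (M y)) ∨
      ∃ (a : E3) (μ : ℝ), a ≠ 0 ∧ (∀ y : E3, M y = μ • ((3 * inner ℝ a y) • a - (inner ℝ a a) • y)) ∧
        ∀ y : E3, inner ℝ y (Literature.Analysis.FluidPDE.cross
          (gradient (fun z : E3 => MvPolynomial.eval (fun i => z i) H) y) a) = 0 :=
  harmonicBracketRigidity_of_eulerTop CentreJet.eulerTopFirstIntegrals CentreJet.noHarmonicPolhodeInvariant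

end Summit.NavierStokesRegularity.NavierStokesRegularity.Theorems.PoloidalLiouville.ReynoldsQuadrupole

end
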